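import Summits.CriticalPhenomena.Ising3DConformalLimit.Theses.MonotoneRG
import Summits.CriticalPhenomena.Ising3DConformalLimit.Theorems.HyperoctahedralRPExistsScaleCovariantLimitRegularityGivesPrecompact
import Summits.CriticalPhenomena.Ising3DConformalLimit.Theorems.MoebiusLimitExists.Negative.MeshContinuity
import Summits.CriticalPhenomena.Ising3DConformalLimit.Theorems.ExistsScaleCovariantLimit.Negative.PinnedForm
import HarnessLib

/-!
# A pinned full-filter limit gives `UniformRegularity` (item stmt-CriticalPhenomena-4658)
(registered stub `stub_uniformRegularity_of_pinnedLimit`, glue "UR", of line `Sketch` of the crux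
`ExistsScaleCovariantLimit`, item stmt-CriticalPhenomena-1981)

`UniformRegularity` (route `MonotoneRG`, verbatim the compactness milestone of
`MirrorHoelderCompactness`) asks, for the critical `ℤ³` Ising correlators rescaled at mesh `δ` and
renormalised by `ρ★(δ) = ⟨σ₀ σ_{⌊δ⁻¹⌋ e₀}⟩_{β_c}^{-1/2}` (which IS the pinned renormalisation `rhoPin`,
`rhoStar_eq_rhoPin`), on every compact set `K` of non-coincident configurations: (a) a uniform
bound for `δ ∈ (0, δ₀)`, (b) uniform equicontinuity for `δ ∈ (0, δ₀)`, (c) at `n = 2` a positive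
lower bound for `δ ∈ (0, δ₀)`.

If the pinned zoom converges along the FULL filter `𝓝[>] 0`, locally uniformly on
`NonCoincident 3 n`, to some family `S` (the pinned form of the crux, `iff_pinned`), all three are
elementary: the convergence is uniform on the compact `K` and the limit `S n` is continuous on
`NonCoincident 3 n` (mesh continuity, `LimitMeshContinuity.continuousOn_limit`), so (a) follows
from a bound for `S n` on `K`, (b) from Heine–Cantor for `S n` on `K` by the `ε/3` argument, and
(c) from the positivity of `S 2` off the diagonal (pinning `S₂(0,e₀) = 1`,
`isNondegenerateTwoPoint_iff_exists_pos`) and the positive minimum of `S 2` on `K`; an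
`∀ᶠ δ in 𝓝[>] 0` statement is unpacked into `∃ δ₀ > 0, ∀ δ ∈ Set.Ioo 0 δ₀` by the basis
`nhdsGT_basis`.

No lattice input beyond the hypothesis; no named unproved fact. References: folklore (uniform
convergence on compacts + Heine–Cantor), `continuousOn_limit`, `pinned_cfg01`, `rhoStar_eq_rhoPin`.
-/

noncomputable section

open Literature.Probability.LatticeModels Filter Set
open scoped Topology
open Summit.CriticalPhenomena.Ising3DConformalLimit.MoebiusLimitExistsOnlyInteraction (rhoPin)

namespace Summit.CriticalPhenomena.Ising3DConformalLimit.Cruxes.ExistsScaleCovariantLimit.TwoHierarchies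

/-! ### Three abstract lemmas: locally uniform convergence to a continuous limit, on a compact -/

/-- An eventuality along `𝓝[>] 0` in `ℝ` holds on a whole interval `(0, δ₀)`, `δ₀ > 0`. [folklore] -/
theorem exists_Ioo_of_eventually_nhdsGT {P : ℝ → Prop} (h : ∀ᶠ δ in 𝓝[>] (0:ℝ), P δ) :
    ∃ δ₀ : ℝ, 0 < δ₀ ∧ ∀ δ ∈ Set.Ioo 0 δ₀, P δ := by
  obtain ⟨b, hb, hP⟩ := (nhdsGT_basis (0:ℝ)).eventually_iff.1 h
  exact ⟨b, hb, fun δ hδ => hP hδ⟩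

/-- **(a) abstract.** If `F δ → f` locally uniformly on `s` along `𝓝[>] 0`, `f` is continuous on `s`
and `K ⊆ s` is compact, then `|F δ x| ≤ M` on `K` for all `δ ∈ (0, δ₀)`. [folklore] -/
theorem exists_bound_Ioo_of_tendstoLocallyUniformlyOn {X : Type*} [PseudoMetricSpace X]
    {F : ℝ → X → ℝ} {f : X → ℝ} {s K : Set X}
    (h : TendstoLocallyUniformlyOn F f (𝓝[>] (0:ℝ)) s) (hf : ContinuousOn f s)
    (hK : IsCompact K) (hKs : K ⊆ s) :
    ∃ M δ₀ : ℝ, 0 < δ₀ ∧ ∀ δ ∈ Set.Ioo 0 δ₀, ∀ x ∈ K, |F δ x| ≤ M := by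
  have hU : TendstoUniformlyOn F f (𝓝[>] (0:ℝ)) K :=
    (tendstoLocallyUniformlyOn_iff_tendstoUniformlyOn_of_compact hK).1 (h.mono hKs)
  obtain ⟨C, hC⟩ := hK.exists_bound_of_continuousOn (hf.mono hKs)
  obtain ⟨δ₀, hδ₀, hev⟩ :=
    exists_Ioo_of_eventually_nhdsGT (Metric.tendstoUniformlyOn_iff.1 hU 1 one_pos)
  refine ⟨C + 1, δ₀, hδ₀, fun δ hδ x hx => ?_⟩
  have h1 : dist (f x) (F δ x) < 1 := hev δ hδ x hx
  have h2 : ‖f x‖ ≤ C := hC x hx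
  rw [Real.dist_eq] at h1
  rw [Real.norm_eq_abs] at h2
  have h3 := abs_sub_abs_le_abs_sub (F δ x) (f x)
  rw [abs_sub_comm] at h3
  linarith

/-- **(b) abstract.** If `F δ → f` locally uniformly on `s` along `𝓝[>] 0`, `f` is continuous on `s`
and `K ⊆ s` is compact, then the `F δ`, `δ ∈ (0, δ₀)`, are uniformly equicontinuous on `K`
(`ε/3`: uniform convergence on `K` + Heine–Cantor for `f` on `K`). [folklore] -/
theorem equicontinuous_Ioo_of_tendstoLocallyUniformlyOn {X : Type*} [PseudoMetricSpace X]
    {F : ℝ → X → ℝ} {f : X → ℝ} {s K : Set X}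
    (h : TendstoLocallyUniformlyOn F f (𝓝[>] (0:ℝ)) s) (hf : ContinuousOn f s)
    (hK : IsCompact K) (hKs : K ⊆ s) :
    ∀ ε : ℝ, 0 < ε → ∃ r δ₀ : ℝ, 0 < r ∧ 0 < δ₀ ∧ ∀ δ ∈ Set.Ioo 0 δ₀, ∀ x ∈ K, ∀ y ∈ K,
      dist x y < r → |F δ x - F δ y| < ε := by
  intro ε hε
  have hε3 : 0 < ε / 3 := by positivity
  have hU : TendstoUniformlyOn F f (𝓝[>] (0:ℝ)) K :=
    (tendstoLocallyUniformlyOn_iff_tendstoUniformlyOn_of_compact hK).1 (h.mono hKs)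
  have hUC : UniformContinuousOn f K := hK.uniformContinuousOn_of_continuous (hf.mono hKs)
  obtain ⟨η, hη, hηf⟩ := Metric.uniformContinuousOn_iff.1 hUC (ε / 3) hε3
  obtain ⟨δ₀, hδ₀, hev⟩ :=
    exists_Ioo_of_eventually_nhdsGT (Metric.tendstoUniformlyOn_iff.1 hU (ε / 3) hε3)
  refine ⟨η, δ₀, hη, hδ₀, fun δ hδ x hx y hy hxy => ?_⟩
  have h1 : dist (F δ x) (f x) < ε / 3 := by rw [dist_comm]; exact hev δ hδ x hx
  have h2 : dist (f x) (f y) < ε / 3 := hηf x hx y hy hxy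
  have h3 : dist (f y) (F δ y) < ε / 3 := hev δ hδ y hy
  rw [← Real.dist_eq]
  calc dist (F δ x) (F δ y) ≤ dist (F δ x) (f x) + dist (f x) (f y) + dist (f y) (F δ y) :=
        dist_triangle4 _ _ _ _
    _ < ε / 3 + ε / 3 + ε / 3 := add_lt_add (add_lt_add h1 h2) h3
    _ = ε := by ring

/-- **(c) abstract.** If `F δ → f` locally uniformly on `s` along `𝓝[>] 0`, `f` is continuous on `s`,
`K ⊆ s` is compact and `f > 0` on `K`, then `m ≤ F δ x` on `K` for all `δ ∈ (0, δ₀)`, for some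
`m > 0` (half a positive lower bound of `f` on `K`). [folklore] -/
theorem exists_pos_lower_Ioo_of_tendstoLocallyUniformlyOn {X : Type*} [PseudoMetricSpace X]
    {F : ℝ → X → ℝ} {f : X → ℝ} {s K : Set X}
    (h : TendstoLocallyUniformlyOn F f (𝓝[>] (0:ℝ)) s) (hf : ContinuousOn f s)
    (hK : IsCompact K) (hKs : K ⊆ s) (hpos : ∀ x ∈ K, 0 < f x) :
    ∃ m δ₀ : ℝ, 0 < m ∧ 0 < δ₀ ∧ ∀ δ ∈ Set.Ioo 0 δ₀, ∀ x ∈ K, m ≤ F δ x := by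
  have hU : TendstoUniformlyOn F f (𝓝[>] (0:ℝ)) K :=
    (tendstoLocallyUniformlyOn_iff_tendstoUniformlyOn_of_compact hK).1 (h.mono hKs)
  obtain ⟨m₀, hm₀, hlow⟩ := hK.exists_forall_le' (hf.mono hKs) hpos
  have hm2 : 0 < m₀ / 2 := by positivity
  obtain ⟨δ₀, hδ₀, hev⟩ :=
    exists_Ioo_of_eventually_nhdsGT (Metric.tendstoUniformlyOn_iff.1 hU (m₀ / 2) hm2)
  refine ⟨m₀ / 2, δ₀, hm2, hδ₀, fun δ hδ x hx => ?_⟩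
  have h1 : dist (f x) (F δ x) < m₀ / 2 := hev δ hδ x hx
  have h2 : m₀ ≤ f x := hlow x hx
  rw [Real.dist_eq] at h1
  have h3 := (abs_lt.1 h1).2
  linarith

/-! ### The stub -/

/-- **UR — a pinned full-filter limit gives item stmt-CriticalPhenomena-4658 `UniformRegularity`.**
From `HasPointwiseScalingLimit (criticalCorr 3) rhoPin S`: the renormalisation `ρ★` written inline in
`UniformRegularity` is `rhoPin` (`rhoStar_eq_rhoPin`); on a compact `K ⊆ NonCoincident 3 n` the
convergence is uniform along `𝓝[>] 0` and the limit `S n` is continuous there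
(`LimitMeshContinuity.continuousOn_limit`), whence (a) a uniform bound and (b) uniform
equicontinuity for `δ ∈ (0, δ₀)`; (c) `S 2 > 0` off the diagonal (pinning `S₂(0,e₀) = 1`,
`pinned_cfg01`, and `isNondegenerateTwoPoint_iff_exists_pos`), so half its positive minimum on a
compact `K ⊆ NonCoincident 3 2` bounds the pair zoom below for `δ ∈ (0, δ₀)`. [folklore] -/
theorem stub_uniformRegularity_of_pinnedLimit :
    (∃ S : CorrFamily 3, HasPointwiseScalingLimit (criticalCorr 3) rhoPin S) →
    Summit.CriticalPhenomena.Ising3DConformalLimit.Theses.MonotoneRG.UniformRegularity := by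
  rintro ⟨S, hlim⟩
  unfold Summit.CriticalPhenomena.Ising3DConformalLimit.Theses.MonotoneRG.UniformRegularity
  rw [rhoStar_eq_rhoPin]
  have hcont : ∀ n, ContinuousOn (S n) (NonCoincident 3 n) := fun n =>
    Summit.CriticalPhenomena.Ising3DConformalLimit.LimitMeshContinuity.continuousOn_limit hlim n
  refine ⟨fun n K hKs hK => ⟨?_, ?_⟩, fun K hKs hK => ?_⟩
  · -- (a) uniform bound on `K`
    exact exists_bound_Ioo_of_tendstoLocallyUniformlyOn (hlim n) (hcont n) hK hKs
  · -- (b) uniform equicontinuity on `K`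
    exact equicontinuous_Ioo_of_tendstoLocallyUniformlyOn (hlim n) (hcont n) hK hKs
  · -- (c) positive lower bound of the pair zoom on `K`
    have h1 := Summit.CriticalPhenomena.Ising3DConformalLimit.ExistsScaleCovariantLimitNegative.pinned_cfg01
      hlim
    have hnd : IsNondegenerateTwoPoint S :=
      (Summit.CriticalPhenomena.Ising3DConformalLimit.MoebiusLimitExistsNegative.isNondegenerateTwoPoint_iff_exists_pos
        hlim).2 ⟨_, Summit.CriticalPhenomena.Ising3DConformalLimit.PinnedClusterPoints.cfg01_mem,
          by rw [h1]; exact one_pos⟩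
    exact exists_pos_lower_Ioo_of_tendstoLocallyUniformlyOn (hlim 2) (hcont 2) hK hKs
      fun x hx => hnd x (hKs hx)

end Summit.CriticalPhenomena.Ising3DConformalLimit.Cruxes.ExistsScaleCovariantLimit.TwoHierarchies

end
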